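import Summits.RiemannHypothesis.RiemannHypothesis.Theorems.JensenLogBandArcModelCompareNumeric
import HarnessLib

/-!
# Main term versus translated-saddle model, IV: per-point window hypotheses ([CMP], near zone)

RH ladder column JENSEN, rung J-P(P3) «log band», BAND crux `XiDerivBandRealAllRates`
(stmt-RiemannHypothesis-19913) of route «JensenLogBand», line «band-one-window» (top-shell reshape,
BAND lead rh-jensen-prover g8). RH-FREE. WHAT THIS IS NOT: nothing here bears on zeros of `ζ` off the
line or the truth of RH.

The lead's transfer assembly for `stub_shellNear` (STATUS 2026-08-27T06:50:32Z) works on discs of radius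
`R = a₀/2` about the own centre `v₀`, where the window margin `g(v₀) = Re(½+u₀) − 1 ≈ a₀ − 8/ℓ` is SMALLER
than `2R`: the base-window hypothesis `1 + δ + 2R ≤ Re(½+u₀)` of `norm_arcMainTerm_sub_arcShiftModel_le`
cannot be met there. This file restates [CMP] with the two windows as PER-POINT hypotheses —
`1 + δ ≤ Re(½ + ũ)` for the translate `ũ = u₀ − c₀ + c` (`= Re(½+u₀) + (x − x₀)`) and `1 + δ ≤ Re(½ + u*)` for
the saddle at `c` (`≥ ½ + x + h − ε`, `LogBandArc.arcSaddle_sharp_polar`) — which at every point of the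
`a₀/2`-disc hold with `δ = a₀/4` eventually (theory g12 HDISC-RECIPE (w1): margin `≥ a₀ − 8.3/ℓ − a₀/2`).
Same proof as part II otherwise.

* `norm_arcMainTerm_sub_arcShiftModel_le_of_window` — product form;
* `norm_arcMainTerm_sub_arcShiftModel_le_of_window_of_large` — `ε = 1/100` under `10⁴·n² ≤ δ·T₀`.

(prover-rh-jensen-eng-2-g7-0, 2026-08-27.)
-/

noncomputable section

-- single-problem summit: `Summit.RiemannHypothesis.RiemannHypothesis.…` is the tree convention
set_option linter.dupNamespace false

open Complex Real Set Metric
open scoped Interval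

namespace Summit.RiemannHypothesis.RiemannHypothesis.Theorems.JensenPolynomials.LogBandArc

open Literature.NumberTheory.LFunctions

section window

variable {n : ℕ} {x₀ T₀ x T R : ℝ} {u₀ u : ℂ}

set_option maxHeartbeats 800000 in -- long chain of explicit norm estimates in a large context, no search
/-- **[CMP] (product form, per-point windows).** Two centres `c₀ = x₀ + iT₀`, `c = x + iT` in regime R2 (`h₀, h ≤ 20`) with
`‖c − c₀‖ ≤ R ≤ 1/20`, `|h − h₀| ≤ h/20`; saddles `u₀`, `u*` in their S3 discs; the TWO windows right of
`1 + δ`: `1 + δ ≤ Re(½ + ũ)` (`ũ = u₀ − c₀ + c`, i.e. `Re(½+u₀) + (x − x₀)`) and `1 + δ ≤ Re(½ + u*)` — the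
form needed on discs of radius `R = a₀/2` about the own centre, where the base-window form
`1 + δ + 2R ≤ Re(½+u₀)` of `norm_arcMainTerm_sub_arcShiftModel_le` is too demanding. Then, with `d = 110·n·R/(T₀ ℓ_T ℓ_{T₀})`,
`ε₁ = (33/(4T) + 1/(0.79T)² + (n+1)/(1.79T)² + 25n/(4h²))·d²`, `ε₂ = d/δ`,
`ε₃ = √2·(7.7(h²/T + h₀²/T₀))/((11/40)n)`:
`‖Main(c,u*) − M̃_{c₀,u₀}(c)‖ ≤ ((1 + ε₁e^{ε₁})(1 + ε₂e^{ε₂})(1 + ε₃) − 1)·‖M̃_{c₀,u₀}(c)‖`.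
RH-FREE. [folklore] -/
theorem norm_arcMainTerm_sub_arcShiftModel_le_of_window (hx₀ : |x₀| ≤ 1 / 2) (hT₀ : 100 ≤ T₀)
    (hℓ₀ : 20 ≤ ell T₀) (hn : 100 ≤ n) (hh₀ : 1 / 2 ≤ bandRadius n T₀)
    (hh₀T : bandRadius n T₀ ≤ 7 / 20 * T₀) (hH₀ : bandRadius n T₀ ≤ 20)
    (hu₀ : ‖u₀ - ((x₀ : ℂ) + (T₀ : ℂ) * I + bandRadius n T₀)‖ ≤ 3 / 5 * bandRadius n T₀)
    (hS₀ : arcSaddleFn n ((x₀ : ℂ) + (T₀ : ℂ) * I) u₀ = 0)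
    (hx : |x| ≤ 1 / 2) (hT : 100 ≤ T) (hℓ : 20 ≤ ell T) (hh : 1 / 2 ≤ bandRadius n T)
    (hhT : bandRadius n T ≤ 7 / 20 * T) (hH : bandRadius n T ≤ 20)
    (hu : ‖u - ((x : ℂ) + (T : ℂ) * I + bandRadius n T)‖ ≤ 3 / 5 * bandRadius n T)
    (hS : arcSaddleFn n ((x : ℂ) + (T : ℂ) * I) u = 0)
    (hR : R ≤ 1 / 20) (hcc : ‖((x : ℂ) + (T : ℂ) * I) - ((x₀ : ℂ) + (T₀ : ℂ) * I)‖ ≤ R)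
    (hhh : |bandRadius n T - bandRadius n T₀| ≤ bandRadius n T / 20)
    {δ : ℝ} (hδ : 0 < δ)
    (hσt : 1 + δ ≤ (1 / 2 + (u₀ - ((x₀ : ℂ) + (T₀ : ℂ) * I) + ((x : ℂ) + (T : ℂ) * I))).re)
    (hσu : 1 + δ ≤ (1 / 2 + u).re) :
    ‖arcMainTerm n ((x : ℂ) + (T : ℂ) * I) u -
        arcShiftModel n ((x₀ : ℂ) + (T₀ : ℂ) * I) u₀ ((x : ℂ) + (T : ℂ) * I)‖ ≤
      ((1 + ((33 / 4 / T + 1 / (79 / 100 * T) ^ 2 + ((n : ℝ) + 1) / (179 / 100 * T) ^ 2 +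
            25 * n / (4 * bandRadius n T ^ 2)) * (110 * n * R / (T₀ * ell T * ell T₀)) ^ 2) *
          Real.exp ((33 / 4 / T + 1 / (79 / 100 * T) ^ 2 + ((n : ℝ) + 1) / (179 / 100 * T) ^ 2 +
            25 * n / (4 * bandRadius n T ^ 2)) * (110 * n * R / (T₀ * ell T * ell T₀)) ^ 2)) *
        (1 + (110 * n * R / (T₀ * ell T * ell T₀)) / δ *
          Real.exp ((110 * n * R / (T₀ * ell T * ell T₀)) / δ)) *
        (1 + Real.sqrt 2 * (77 / 10 * (bandRadius n T ^ 2 / T + bandRadius n T₀ ^ 2 / T₀)) /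
          (11 / 40 * n)) - 1) *
      ‖arcShiftModel n ((x₀ : ℂ) + (T₀ : ℂ) * I) u₀ ((x : ℂ) + (T : ℂ) * I)‖ := by
  -- bookkeeping
  obtain ⟨-, hεh₀, -, hT1200₀, hnT₀⟩ := R2_bookkeeping hT₀ hℓ₀ hh₀ hH₀
  obtain ⟨-, hεh, -, hT1200, hnT⟩ := R2_bookkeeping hT hℓ hh hH
  have hT0 : 0 < T := by linarith
  have hT00 : 0 < T₀ := by linarith
  have hℓpos : 0 < ell T := by linarith
  have hℓ0pos : 0 < ell T₀ := by linarith
  have hR0 : 0 ≤ R := (norm_nonneg _).trans hcc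
  have hnpos : (0 : ℝ) < n := by exact_mod_cast (show 0 < n by omega)
  have hh0 : 0 < bandRadius n T := by linarith
  have hh00 : 0 < bandRadius n T₀ := by linarith
  -- [DISP]
  have hdisp := norm_arcSaddle_sub_translate_le hx₀ hT₀ hℓ₀ hn hh₀ hh₀T hH₀ hu₀ hS₀ hx hT hℓ hh hhT
    hu hS hR hcc hhh
  set d : ℝ := 110 * n * R / (T₀ * ell T * ell T₀) with hddef
  have hd0 : 0 ≤ d := by positivity
  have hdR : d ≤ R / 20 := by
    rw [hddef, div_le_div_iff₀ (by positivity) (by norm_num)]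
    have hn6 : (n : ℝ) ≤ T₀ / 6 := by linarith
    have hℓℓ : (400 : ℝ) ≤ ell T * ell T₀ := by nlinarith
    have h4 : R * (T₀ * 400) ≤ R * (T₀ * (ell T * ell T₀)) :=
      mul_le_mul_of_nonneg_left (mul_le_mul_of_nonneg_left hℓℓ hT00.le) hR0
    have h5 : 110 * (n : ℝ) * R * 20 ≤ 110 * (T₀ / 6) * R * 20 := by gcongr
    have e : 110 * (T₀ / 6) * R * 20 ≤ R * (T₀ * 400) := by nlinarith
    linarith
  have hdh : d ≤ bandRadius n T / 5 := by linarith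
  have hdist : ‖u - (u₀ - ((x₀ : ℂ) + (T₀ : ℂ) * I) + ((x : ℂ) + (T : ℂ) * I))‖ ≤ d := hdisp
  -- (i) the density factor
  obtain ⟨E, hPE, hEn⟩ := arcDensity_saddle_eq_mul_exp hx hT hℓ hn hh hhT hH hu hS hdist hdh
  -- the translate lies in the disc about `c + h`; good-point facts there and at `u*`
  have hε := norm_arcSaddle_sub_center_sub_radius_le hx hT hℓ hn hh hhT hH hu hS
  have hut_disc : ‖(u₀ - ((x₀ : ℂ) + (T₀ : ℂ) * I) + ((x : ℂ) + (T : ℂ) * I)) -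
      ((x : ℂ) + (T : ℂ) * I + bandRadius n T)‖ ≤ 3 / 5 * bandRadius n T := by
    have e : (u₀ - ((x₀ : ℂ) + (T₀ : ℂ) * I) + ((x : ℂ) + (T : ℂ) * I)) -
        ((x : ℂ) + (T : ℂ) * I + bandRadius n T) =
        (u - ((x : ℂ) + (T : ℂ) * I + bandRadius n T)) -
          (u - (u₀ - ((x₀ : ℂ) + (T₀ : ℂ) * I) + ((x : ℂ) + (T : ℂ) * I))) := by ring
    rw [e]
    refine (norm_sub_le _ _).trans ?_
    linarith
  obtain ⟨hre_t, h1_t, h0_t, hc_t, hpc_t, -⟩ := disc_good_point hx hT hh hhT hut_disc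
  -- (iii) curvature facts at both centres
  have hw := norm_arcCurv_sub_half_le hx hT hℓ hn hh hhT hH hu hS
  have hw₀ := norm_arcCurv_sub_half_le hx₀ hT₀ hℓ₀ hn hh₀ hh₀T hH₀ hu₀ hS₀
  obtain ⟨hwre, -⟩ := arcCurv_re_norm hx hT hℓ hn hh hhT hu hS
  obtain ⟨hw₀re, -⟩ := arcCurv_re_norm hx₀ hT₀ hℓ₀ hn hh₀ hh₀T hu₀ hS₀
  -- names
  generalize hc₀ : ((x₀ : ℂ) + (T₀ : ℂ) * I) = c₀ at *
  generalize hc : ((x : ℂ) + (T : ℂ) * I) = c at *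
  set ut : ℂ := u₀ - c₀ + c with hut
  set w : ℂ := arcCurv n c u with hwdef
  set w₀ : ℂ := arcCurv n c₀ u₀ with hw₀def
  set s₀ : ℂ := 1 / 2 + ut with hs₀
  set s : ℂ := 1 / 2 + u with hs
  set M : ℝ := 33 / 4 / T + 1 / (79 / 100 * T) ^ 2 + ((n : ℝ) + 1) / (179 / 100 * T) ^ 2 +
    25 * n / (4 * bandRadius n T ^ 2) with hM
  -- (ii) the `ζ` factor
  have hs₀re : 1 + δ ≤ s₀.re := hσt
  have hsd : ‖s - s₀‖ ≤ d := by rw [show s - s₀ = u - ut by rw [hs, hs₀]; ring]; exact hdist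
  have hsre : 1 + δ ≤ s.re := hσu
  have hζ := norm_riemannZeta_div_sub_one_le_of_norm_le hδ hs₀re hsre hsd
  have hζ₀ : riemannZeta s₀ ≠ 0 := riemannZeta_ne_zero_of_one_lt_re (by linarith)
  -- (iii) the curvature factor
  have hwre0 : 0 < w.re := lt_of_lt_of_le (by positivity) hwre
  have hw₀re0 : 0 < w₀.re := lt_of_lt_of_le (by positivity) hw₀re
  have hw0 : w ≠ 0 := fun h => by rw [h] at hwre0; simp at hwre0
  have hw₀0 : w₀ ≠ 0 := fun h => by rw [h] at hw₀re0; simp at hw₀re0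
  have hQ := norm_sqrt_pi_div_sub_le hwre0 hw₀re0
  set Q : ℂ := ((π : ℂ) / w) ^ (1 / 2 : ℂ) with hQdef
  set Q₀ : ℂ := ((π : ℂ) / w₀) ^ (1 / 2 : ℂ) with hQ₀def
  have hQ₀0 : Q₀ ≠ 0 := by
    rw [hQ₀def, Ne, Complex.cpow_eq_zero_iff, not_and_or]
    left
    exact div_ne_zero (by exact_mod_cast Real.pi_ne_zero) hw₀0
  have hnQ₀ : 0 < ‖Q₀‖ := norm_pos_iff.2 hQ₀0
  have hww₀ : ‖w - w₀‖ ≤ 77 / 10 * (bandRadius n T ^ 2 / T + bandRadius n T₀ ^ 2 / T₀) := by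
    have e : w - w₀ = (w - (n : ℂ) / 2) - (w₀ - (n : ℂ) / 2) := by ring
    rw [e]
    refine (norm_sub_le _ _).trans ?_
    have e2 : 77 / 10 * (bandRadius n T ^ 2 / T + bandRadius n T₀ ^ 2 / T₀) =
        77 / 10 * bandRadius n T ^ 2 / T + 77 / 10 * bandRadius n T₀ ^ 2 / T₀ := by ring
    rw [e2]; exact add_le_add hw hw₀
  have hwn : 11 / 40 * (n : ℝ) ≤ ‖w‖ := hwre.trans (Complex.re_le_norm w)
  have hratio : ‖w - w₀‖ / ‖w‖ ≤
      77 / 10 * (bandRadius n T ^ 2 / T + bandRadius n T₀ ^ 2 / T₀) / (11 / 40 * n) :=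
    div_le_div₀ (by positivity) hww₀ (by positivity) hwn
  have hQrel : ‖Q / Q₀ - 1‖ ≤ Real.sqrt 2 *
      (77 / 10 * (bandRadius n T ^ 2 / T + bandRadius n T₀ ^ 2 / T₀)) / (11 / 40 * n) := by
    have e : Q / Q₀ - 1 = (Q - Q₀) / Q₀ := by field_simp
    rw [e, norm_div, div_le_iff₀ hnQ₀]
    refine hQ.trans ?_
    rw [mul_div_assoc]
    gcongr
  -- (i) the density factor, as a bound on `‖e^E − 1‖`
  have hM0 : 0 ≤ M := by positivity
  have hEexp : ‖Complex.exp E - 1‖ ≤ M * d ^ 2 * Real.exp (M * d ^ 2) := by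
    refine (norm_cexp_sub_one_le_mul_exp E).trans ?_
    exact mul_le_mul hEn (Real.exp_le_exp.2 hEn) (Real.exp_pos _).le (by positivity)
  -- the algebra: `Main − M̃ = M̃ · (e^E · ζ-ratio · Q/Q₀ − 1)`
  have hmodel : arcMainTerm n c u - arcShiftModel n c₀ u₀ c =
      arcShiftModel n c₀ u₀ c *
        (Complex.exp E * (riemannZeta s / riemannZeta s₀) * (Q / Q₀) - 1) := by
    rw [arcMainTerm, arcShiftModel, hPE]
    simp only [← hs, ← hs₀, ← hut]
    field_simp
    ring
  rw [hmodel, norm_mul, mul_comm]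
  refine mul_le_mul_of_nonneg_right ?_ (norm_nonneg _)
  exact norm_mul_mul_sub_one_le hEexp hζ hQrel


/-- **[CMP] (numeric form, per-point windows).** Under the hypotheses of
`norm_arcMainTerm_sub_arcShiftModel_le_of_window` (radius closeness automatic) and `10⁴·n² ≤ δ·T₀`:
`‖Main(c,u*) − M̃_{c₀,u₀}(c)‖ ≤ (1/100)·‖M̃_{c₀,u₀}(c)‖` — the `ε‖M‖` input of the log-derivative
transfer `LogBand.LogDerivTransfer.re_logDeriv_ge_of_norm_sub_le` for the model comparison part.
RH-FREE. [folklore] -/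
theorem norm_arcMainTerm_sub_arcShiftModel_le_of_window_of_large (hx₀ : |x₀| ≤ 1 / 2) (hT₀ : 100 ≤ T₀)
    (hℓ₀ : 20 ≤ ell T₀) (hn : 100 ≤ n) (hh₀ : 1 / 2 ≤ bandRadius n T₀)
    (hh₀T : bandRadius n T₀ ≤ 7 / 20 * T₀) (hH₀ : bandRadius n T₀ ≤ 20)
    (hu₀ : ‖u₀ - ((x₀ : ℂ) + (T₀ : ℂ) * I + bandRadius n T₀)‖ ≤ 3 / 5 * bandRadius n T₀)
    (hS₀ : arcSaddleFn n ((x₀ : ℂ) + (T₀ : ℂ) * I) u₀ = 0)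
    (hx : |x| ≤ 1 / 2) (hT : 100 ≤ T) (hℓ : 20 ≤ ell T) (hh : 1 / 2 ≤ bandRadius n T)
    (hhT : bandRadius n T ≤ 7 / 20 * T) (hH : bandRadius n T ≤ 20)
    (hu : ‖u - ((x : ℂ) + (T : ℂ) * I + bandRadius n T)‖ ≤ 3 / 5 * bandRadius n T)
    (hS : arcSaddleFn n ((x : ℂ) + (T : ℂ) * I) u = 0)
    (hR : R ≤ 1 / 20) (hcc : ‖((x : ℂ) + (T : ℂ) * I) - ((x₀ : ℂ) + (T₀ : ℂ) * I)‖ ≤ R)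
    {δ : ℝ} (hδ : 0 < δ)
    (hσt : 1 + δ ≤ (1 / 2 + (u₀ - ((x₀ : ℂ) + (T₀ : ℂ) * I) + ((x : ℂ) + (T : ℂ) * I))).re)
    (hσu : 1 + δ ≤ (1 / 2 + u).re) (hlarge : (10 : ℝ) ^ 4 * (n : ℝ) ^ 2 ≤ δ * T₀) :
    ‖arcMainTerm n ((x : ℂ) + (T : ℂ) * I) u -
        arcShiftModel n ((x₀ : ℂ) + (T₀ : ℂ) * I) u₀ ((x : ℂ) + (T : ℂ) * I)‖ ≤
      1 / 100 * ‖arcShiftModel n ((x₀ : ℂ) + (T₀ : ℂ) * I) u₀ ((x : ℂ) + (T : ℂ) * I)‖ := by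
  have hTT₀ : |T - T₀| ≤ R := by
    have := (Complex.abs_im_le_norm (((x : ℂ) + (T : ℂ) * I) - ((x₀ : ℂ) + (T₀ : ℂ) * I))).trans hcc
    simpa using this
  have hhh : |bandRadius n T - bandRadius n T₀| ≤ bandRadius n T / 20 :=
    abs_bandRadius_sub_le hT hT₀ hℓ hℓ₀ (hTT₀.trans hR)
  have hmain := norm_arcMainTerm_sub_arcShiftModel_le_of_window hx₀ hT₀ hℓ₀ hn hh₀ hh₀T hH₀ hu₀ hS₀ hx
    hT hℓ hh hhT hH hu hS hR hcc hhh hδ hσt hσu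
  obtain ⟨-, -, -, hT1200₀, hnT₀⟩ := R2_bookkeeping hT₀ hℓ₀ hh₀ hH₀
  obtain ⟨-, -, -, hT1200, hnT⟩ := R2_bookkeeping hT hℓ hh hH
  obtain ⟨-, -, -, hre_hi, -⟩ := disc_geometry hx hT hh hhT hu
  have hR0 : 0 ≤ R := (norm_nonneg _).trans hcc
  have hδ32 : δ ≤ 32 := by linarith
  have hN : (100 : ℝ) ≤ n := by exact_mod_cast hn
  have key := cmp_product_le hN hT1200 hT1200₀ hℓ hℓ₀ hh hH hh₀ hH₀ hR0 hR hδ hδ32 hlarge hnT hnT₀ hTT₀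
  exact hmain.trans (mul_le_mul_of_nonneg_right key (norm_nonneg _))


end window

end Summit.RiemannHypothesis.RiemannHypothesis.Theorems.JensenPolynomials.LogBandArc

end
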